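import Literature.AlgebraicGeometry.Resolution.ProjectiveStrongResolution
import Literature.AlgebraicGeometry.Resolution.GraphClosureCompactification
import Literature.AlgebraicGeometry.HodgeTheory.SmoothProjectiveCompactification
import HarnessLib

/-!
# Smooth projective compactifications of smooth quasi-projective varieties (Hironaka 1964) — PROVED

Family `hodge`, layer `Literature/AlgebraicGeometry/HodgeTheory`. Sibling PROOFS file of
`SmoothProjectiveCompactification.lean`, which vendors the named fact
`Hironaka1964_smoothCompactification_algClosed` (and `EGAII_isQuasiProjectiveOver_of_isFinite`,
not treated here). H. Hironaka, *Resolution of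
singularities of an algebraic variety over a field of characteristic zero*, Ann. of Math. 79
(1964), Main Theorem I, in the form quoted by Y. André, *Pour une théorie inconditionnelle des
motifs*, Publ. Math. IHÉS 83 (1996), §5.1 p. 25 ("`X` est un schéma quasi projectif lisse, et il
existe, d'après H. Hironaka, une compactification lisse `X̄` de `X`") and used by C. Voisin, *Hodge
loci and absolute Hodge classes*, Compositio Math. 143 (2007), proof of Prop. 0.7 ("a smooth
projective compactification, defined over `ℚ̄`"): **a smooth, quasi-projective, irreducible
scheme of relative dimension `m` over an algebraically closed field `k` of characteristic zero is
an open subscheme of a smooth projective `k`-variety of dimension `m`**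
(`exists_isSmoothProjective_isOpenImmersion`). Universally quantified over such fields this is, word
for word, the named fact `Hironaka1964_smoothCompactification_algClosed`
(`SmoothProjectiveCompactification.lean`), which is thereby DISCHARGED
(`Hironaka1964_smoothCompactification_algClosed_holds`); its instance `k = ℂ` is the tree's older
named fact `Hironaka1964_smoothCompactification` (`MotivatedClassesDeformationLeaves.lean`), also
DISCHARGED (`Hironaka1964_smoothCompactification_holds`); its instance `k = ℚ̄` is the input `hHir`
of `voisin2007_algebraic_of_finite_monodromyOrbit_of_qbar_of_riemannExistence_hironaka`
(`HodgeGenericQbarDescentFiniteMonodromyInputs.lean`).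

Proof (the classical one: "take the closure in projective space and resolve its singularities,
which lie off `X`"): `X ↪ P ↪ ℙⁿ_k` (quasi-projectivity); the scheme-theoretic image `Z` of
`X → P` is an integral closed subscheme of `ℙⁿ_k` into which `X` maps by an open immersion `s`
(`exists_graphClosure_compactification`, the closure of an open of a reduced scheme); `Z` is
regular at the points of `s(X)` (`X` is smooth over a field, hence regular,
`Scheme.IsRegular.of_smooth`); the STRONG projective resolution of the tree
(`exists_isResolution_isProjectiveOver_isIso`, Kollár 2007 Thm. 3.27 (1)–(2) from Kollár's
functorial order reduction, `ProjectiveStrongResolution.lean`) gives `ρ : Y → Z` with `Y` regular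
and projective over `k` and `ρ` an isomorphism over `s(X)`; so `X ≅ s(X) ≅ ρ⁻¹(s(X)) ⊆ Y` is an
open immersion over `k`, `Y` is smooth over the perfect field `k` (`smooth_of_isRegular_of_perfectField`),
geometrically irreducible (`k = k̄`), and of dimension `dim Y = dim X = m` (a non-empty open of an
irreducible variety has full dimension). No definition and no named fact is introduced.

## Main results

* `exists_isSmoothProjective_isOpenImmersion` — Hironaka's smooth projective compactification over
  any algebraically closed field of characteristic zero.
* `Hironaka1964_smoothCompactification_algClosed_holds` — DISCHARGE of the named fact
  `Hironaka1964_smoothCompactification_algClosed` (every algebraically closed field of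
  characteristic zero, every universe).
* `Hironaka1964_smoothCompactification_holds` — DISCHARGE of the named fact
  `Hironaka1964_smoothCompactification` (the case `k = ℂ`).

## References

* [Hironaka1964] H. Hironaka, Ann. of Math. 79 (1964), Main Theorem I (pp. 132, 170).
* [Kollar2007] J. Kollár, *Lectures on Resolution of Singularities* (2007), Thm. 3.27 (p. 126).
* [Andre1996Motifs] Y. André, Publ. Math. IHÉS 83 (1996), §5.1 (p. 25).
* [Voisin2007HodgeLoci] C. Voisin, Compositio Math. 143 (2007), proof of Prop. 0.7.
* [Hartshorne1977] R. Hartshorne, *Algebraic Geometry*, II Ex. 3.20, II Prop. 7.16 (c).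
-/

noncomputable section

open CategoryTheory CategoryTheory.Limits AlgebraicGeometry TopologicalSpace Topology

namespace Literature.AlgebraicGeometry.HodgeTheory

universe u

open Literature.AlgebraicGeometry.Motives Literature.AlgebraicGeometry.Resolution

/-- The open of the ambient scheme cut out on a closed subscheme `ι : Z ↪ P` by an open
`S ⊆ Z`: the complement of the (closed) image of `Z ∖ S`; its trace on `Z` is `S`. [folklore] -/
theorem exists_opens_preimage_eq_of_isClosedImmersion {Z P : Scheme.{u}} (ι : Z ⟶ P)
    [IsClosedImmersion ι] (S : Z.Opens) :
    ∃ O : P.Opens, ∀ z : Z, ι z ∈ O ↔ z ∈ S := by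
  refine ⟨⟨(ι '' (S : Set Z)ᶜ)ᶜ, (ι.isClosedEmbedding.isClosedMap _ S.isOpen.isClosed_compl).isOpen_compl⟩,
    fun z => ?_⟩
  change ι z ∈ (ι '' (S : Set Z)ᶜ)ᶜ ↔ z ∈ S
  rw [Set.mem_compl_iff, ι.isClosedEmbedding.injective.mem_set_image, Set.mem_compl_iff, not_not]
  rfl

/-- **Hironaka's smooth projective compactification, over any algebraically closed field of
characteristic zero** (Hironaka 1964, Main Theorem I, as used by André 1996 §5.1 and Voisin 2007,
proof of Prop. 0.7): a smooth `k`-scheme of relative dimension `m` which is quasi-projective and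
irreducible admits an open `k`-immersion into a smooth projective (geometrically irreducible)
`k`-variety of dimension `m`. Proof in the module docstring: closure in `ℙⁿ_k` with its reduced
structure, strong resolution of the closure isomorphic over the smooth open
(`exists_isResolution_isProjectiveOver_isIso`, Kollár Thm. 3.27), and the dimension count.
[cite: Hironaka1964, Main Theorem I] [cite: Kollar2007, Thm. 3.27 (p. 126)]
[cite: Andre1996Motifs, §5.1 (p. 25)] -/
theorem exists_isSmoothProjective_isOpenImmersion {k : Type u} [Field k] [IsAlgClosed k]
    [CharZero k] (m : ℕ) (X : SchemeOver k) (hX : SmoothOfRelativeDimension m X.hom)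
    (hqp : IsQuasiProjectiveOver X) (hirr : IrreducibleSpace X.left) :
    ∃ (Xbar : SchemeOver k) (i : X ⟶ Xbar), IsSmoothProjective m Xbar ∧ IsOpenImmersion i.left := by
  classical
  haveI := hX
  haveI := hirr
  haveI : Smooth X.hom := SmoothOfRelativeDimension.smooth m X.hom
  -- `X` is regular (smooth over a field) and reduced
  have hXreg : Scheme.IsRegular X.left :=
    Scheme.IsRegular.of_smooth X.hom (Scheme.isRegular_Spec (CommRingCat.of k))
  haveI : IsReduced X.left := hXreg.isReduced
  haveI : IsIntegral X.left := isIntegral_of_irreducibleSpace_of_isReduced X.left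
  -- `X ↪ P ↪ ℙⁿ`
  obtain ⟨P, j, hP, hj⟩ := hqp
  haveI := hj
  obtain ⟨N, e, he⟩ := hP
  haveI := he
  haveI : IsProper (projectiveSpace N k).hom := isProper_projectiveSpace N k
  haveI : IsProper P.hom := by rw [← Over.w e]; infer_instance
  haveI : IsLocallyNoetherian P.left := LocallyOfFiniteType.isLocallyNoetherian P.hom
  -- the closure `Z` of `X` in `P` (scheme-theoretic image), `s : X ↪ Z` open, `c : Z ↪ P` closed
  obtain ⟨Z, c, s, hZint, hc, hsc, hs, -, hpb⟩ :=
    exists_graphClosure_compactification j.left (𝟙 P.left) j.left (Category.comp_id _)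
  haveI := hZint
  haveI := hc
  haveI := hs
  -- the closed immersion `ι : Z ↪ ℙⁿ`
  let ι : Z ⟶ (projectiveSpace N k).left := c ≫ e.left
  haveI : IsClosedImmersion ι := inferInstance
  have hsι : s ≫ ι = j.left ≫ e.left := by rw [← Category.assoc, hsc]
  -- the open `O ⊆ ℙⁿ` with `ι⁻¹(O) = s(X)`
  obtain ⟨O, hO⟩ := exists_opens_preimage_eq_of_isClosedImmersion ι s.opensRange
  have hOmem : ∀ z : Z, ι z ∈ O ↔ z ∈ Set.range s := fun z => by rw [hO]; rfl
  -- `Z` is regular along `s(X)`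
  have hreg : ∀ z : Z, ι z ∈ O → IsRegularLocalRing (Z.presheaf.stalk z) := by
    intro z hz
    obtain ⟨x, rfl⟩ := (hOmem z).mp hz
    haveI := hXreg x
    exact IsRegularLocalRing.of_ringEquiv (stalkEquivOfIsLocalIso s x).symm
  obtain ⟨x₀⟩ := (inferInstance : Nonempty X.left)
  have hOne : ∃ z : Z, ι z ∈ O := ⟨s x₀, (hOmem _).mpr ⟨x₀, rfl⟩⟩
  -- strong projective resolution of `Z`, isomorphic over `s(X)`
  obtain ⟨Y, ρ, hres, hproj, hiso⟩ := exists_isResolution_isProjectiveOver_isIso ι O hOne hreg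
  haveI := hiso
  haveI : IsProper ρ := hres.isProper
  have hYreg : Scheme.IsRegular Y := hres.isRegular
  haveI : IrreducibleSpace Y := hres.isBirational.irreducibleSpace
  haveI : IsReduced Y := hYreg.isReduced
  haveI : IsIntegral Y := isIntegral_of_irreducibleSpace_of_isReduced Y
  -- the structure morphism `πY : Y → Spec k` of the compactification `X̄ = Y`
  obtain ⟨πY, hπY⟩ : ∃ πY : Y ⟶ Spec (CommRingCat.of k), πY = ρ ≫ ι ≫ (projectiveSpace N k).hom :=
    ⟨_, rfl⟩
  have hprojY : IsProjectiveOver (Over.mk πY) := by rw [hπY]; exact hproj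
  -- the open immersion `X ≅ s(X) ≅ ρ⁻¹(s(X)) ⊆ Y`
  set U : Z.Opens := ι ⁻¹ᵁ O with hUdef
  have hrangeU : Set.range s ⊆ Set.range U.ι := by
    rw [Scheme.Opens.range_ι]
    rintro _ ⟨x, rfl⟩
    exact (hOmem _).mpr ⟨x, rfl⟩
  let s' : X.left ⟶ (U : Scheme.{u}) := IsOpenImmersion.lift U.ι s hrangeU
  have hs' : s' ≫ U.ι = s := IsOpenImmersion.lift_fac U.ι s hrangeU
  let il : X.left ⟶ Y := s' ≫ inv (ρ ∣_ U) ≫ (ρ ⁻¹ᵁ U).ι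
  have hilρ : il ≫ ρ = s := by
    simp only [il, Category.assoc]
    rw [← morphismRestrict_ι, IsIso.inv_hom_id_assoc, hs']
  haveI : IsOpenImmersion il := inferInstance
  have hw : il ≫ πY = X.hom := by
    rw [hπY, ← Category.assoc, hilρ, ← Category.assoc, hsι, Category.assoc, Over.w e, Over.w j]
  -- `Y` is smooth over the perfect field `k`, of some relative dimension `d`
  haveI : IsProper πY := IsProjectiveOver.isProper (X := Over.mk πY) hprojY
  haveI : Smooth πY := smooth_of_isRegular_of_perfectField πY hYreg
  obtain ⟨d, hd⟩ := exists_smoothOfRelativeDimension_of_smooth πY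
  haveI := hd
  -- `d = m`: `X` is a non-empty open of `Y`
  have hdim : d = m := by
    have h1 : topologicalKrullDim X.left = (m : WithBot ℕ∞) :=
      topologicalKrullDim_eq_of_smoothOfRelativeDimension X.hom m
    have h2 : topologicalKrullDim Y = (d : WithBot ℕ∞) :=
      topologicalKrullDim_eq_of_smoothOfRelativeDimension πY d
    have h3 : topologicalKrullDim X.left = topologicalKrullDim Y :=
      topologicalKrullDim_eq_of_isOpenImmersion πY il
    rw [h1, h2] at h3
    exact_mod_cast h3.symm
  subst hdim
  -- geometric irreducibility (`k` algebraically closed)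
  haveI := geometricallyIntegral_of_isAlgClosed πY
  have hgi : GeometricallyIrreducible πY := inferInstance
  exact ⟨Over.mk πY, Over.homMk il hw, ⟨hd, hprojY, hgi⟩, inferInstanceAs (IsOpenImmersion il)⟩

/-- DISCHARGE of the named fact `Hironaka1964_smoothCompactification_algClosed`
(`SmoothProjectiveCompactification.lean`: Kollár 2007 Thm. 3.27 (1)–(2) applied to the closure in
projective space; Hironaka 1964, Main Theorem I — smooth projective compactification of a smooth
quasi-projective irreducible scheme over an algebraically closed field of characteristic zero), by
`exists_isSmoothProjective_isOpenImmersion`. [cite: Kollar2007, Thm. 3.27 (p. 126)]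
[cite: Hironaka1964, Main Theorem I] -/
theorem Hironaka1964_smoothCompactification_algClosed_holds :
    Hironaka1964_smoothCompactification_algClosed.{u} :=
  fun _ _ _ _ m X hX hqp hirr => exists_isSmoothProjective_isOpenImmersion m X hX hqp hirr

/-- DISCHARGE of the named fact `Hironaka1964_smoothCompactification`
(`MotivatedClassesDeformationLeaves.lean`: Hironaka 1964, Main Theorem I, in the form quoted by
André 1996 §5.1 — a smooth quasi-projective irreducible complex scheme of relative dimension `m`
is an open subscheme of a smooth projective complex variety of dimension `m`): the case `k = ℂ` of
`exists_isSmoothProjective_isOpenImmersion`. [cite: Hironaka1964, Main Theorem I]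
[cite: Andre1996Motifs, §5.1 (p. 25)] -/
theorem Hironaka1964_smoothCompactification_holds : Hironaka1964_smoothCompactification :=
  fun m X hX hqp hirr => exists_isSmoothProjective_isOpenImmersion m X hX hqp hirr

end Literature.AlgebraicGeometry.HodgeTheory

end
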